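import Mathlib
import HarnessLib

/-!
# The three-term recurrence of orthogonal polynomials: Clenshaw's backward recurrence and the
# Christoffel–Darboux identity — Davis–Rabinowitz (1984) Sect. 1.12 (1.12.8)–(1.12.11)

P. J. Davis and P. Rabinowitz, *Methods of Numerical Integration*, 2nd ed., Academic Press 1984,
Sect. 1.12 "Orthogonal Polynomials", pp. 28–33.

THE TEXT. Orthogonal polynomials `p_n(x) = k_n xⁿ + ⋯`, `k_n > 0`, with respect to an inner product
satisfying `(xf, g) = (f, xg)` obey the three-term recurrence
`p_{n+1}(x) = (γ_n x - α_n) p_n(x) - β_n p_{n-1}(x)`, `n = 0, 1, …`, `p_{-1} = 0` (1.12.8), with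
`γ_n = k_{n+1}/k_n` and `β_n = (γ_n/γ_{n-1}) (p_n, p_n)/(p_{n-1}, p_{n-1})`. The recurrence leads to the
backward recurrence for an expansion `f(x) = Σ_{r=0}^N c_r p_r(x)`: with `B_r = 0` for `r > N` and
`B_r = c_r + (γ x - α) B_{r+1} - β B_{r+2}` for `0 ≤ r ≤ N` (1.12.9), `f(x) = γ_0 B_0` (1.12.10)
(`p_0 ≡ k_0 = γ_0` in the text's normalisation); for Tschebyscheff expansions one selects `α_r = 0`,
`β_r = 1`, `γ_0 = γ_1 = 1`, `γ_r = 2` (`r ≥ 2`). And the Christoffel–Darboux identity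
`Σ_{k=0}^n p_k(x) p_k(y)/h_k = (p_{n+1}(x) p_n(y) - p_n(x) p_{n+1}(y)) / (γ_n h_n (x - y))`,
`h_k = (p_k, p_k)` (1.12.11).

WHAT IS FORMALISED. Both displayed consequences are ALGEBRAIC consequences of (1.12.8) and are recorded
as such, for an arbitrary sequence `p : ℕ → R` (values in a commutative ring, resp. a field) satisfying
the recurrence at a point `x` — so they apply verbatim to polynomial sequences (`R = K[X]`, `x = X`)
and to their evaluations:
* `clenshaw_sum_eq` — (1.12.9)–(1.12.10): if `B_{N+1} = B_{N+2} = 0` and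
  `B_r = c_r + (γ_r x - α_r) B_{r+1} - β_{r+1} B_{r+2}` for `r ≤ N`, then `Σ_{r≤N} c_r p_r = p_0 B_0`;
  `clenshawB` is the backward recurrence itself (well-founded definition) with `clenshawB_sum_eq`.
  INDEXING NOTE: (1.12.9) as printed numbers the recurrence coefficients from `1` — its `γ_{r+1}`,
  `α_{r+1}`, `β_{r+2}` are the coefficients producing `p_{r+1}` from `p_r, p_{r-1}`, i.e. `γ_r`, `α_r`,
  `β_{r+1}` of (1.12.8) (the text's Tschebyscheff choice `γ_0 = γ_1 = 1`, `γ_r = 2` for `r ≥ 2` is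
  `T_1 = x T_0`, `T_{r+1} = 2x T_r - T_{r-1}` in that numbering); we state everything in the numbering
  of (1.12.8).
* `christoffelDarboux_mul` / `christoffelDarboux` — (1.12.11) in cleared form
  `γ_n h_n (x - y) Σ_{k≤n} p_k(x)p_k(y)/h_k = p_{n+1}(x)p_n(y) - p_n(x)p_{n+1}(y)` and, for `x ≠ y`, as
  printed; the hypothesis linking `β` to the norms is the text's formula for `β_n`, in the cleared form
  `β_{n+1} γ_n h_n = γ_{n+1} h_{n+1}`.
* The Tschebyscheff instances: `T` satisfies (1.12.8) with `γ_0 = 1`, `γ_n = 2` (`n ≥ 1`), `α = 0`,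
  `β = 1` (from Mathlib's `Polynomial.Chebyshev.T_add_two`); Clenshaw's rule for `Σ c_r T_r(x)`
  (`= c_0 + x B_1 - B_2`); and Christoffel–Darboux for `T` with the norms `h_0 = π`, `h_k = π/2`
  of the weight `(1 - x²)^{-1/2}` (Mathlib: `integral_eval_T_real_mul_self_measureT_zero`,
  `integral_T_real_mul_self_measureT_of_ne_zero`; `chebyshevNormSq_eq_integral`), where
  `γ_n h_n = π` for every `n`, i.e. concretely
  `1 + 2 Σ_{k=1}^{n} T_k(x) T_k(y) = (T_{n+1}(x)T_n(y) - T_n(x)T_{n+1}(y))/(x - y)` (`christoffelDarboux_T`).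

NOT FORMALISED: the derivation of (1.12.8) from orthogonality (existence of the recurrence for a given
inner product), (1.12.7), and the discrete orthogonality (1.12.5)–(1.12.6).
-/

namespace Literature.Analysis.Quadrature

open Finset

section Ring

variable {R : Type*} [CommRing R]

/-- The three-term recurrence (1.12.8) at the point `x`, in the numbering of (1.12.8):
`p_1 = (γ_0 x - α_0) p_0` (i.e. `p_{-1} = 0`) and `p_{n+2} = (γ_{n+1} x - α_{n+1}) p_{n+1} - β_{n+1} p_n`.
[cite: DavisRabinowitz1984, Sect. 1.12 (1.12.8)] -/
structure IsThreeTermRecurrence (γ α β : ℕ → R) (x : R) (p : ℕ → R) : Prop where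
  /-- The first step `p_1 = (γ_0 x - α_0) p_0` (`p_{-1} = 0`). [cite: DavisRabinowitz1984, Sect. 1.12 (1.12.8)] -/
  one : p 1 = (γ 0 * x - α 0) * p 0
  /-- The generic step `p_{n+2} = (γ_{n+1} x - α_{n+1}) p_{n+1} - β_{n+1} p_n`.
  [cite: DavisRabinowitz1984, Sect. 1.12 (1.12.8)] -/
  add_two : ∀ n, p (n + 2) = (γ (n + 1) * x - α (n + 1)) * p (n + 1) - β (n + 1) * p n

/-- **Clenshaw's backward recurrence, (1.12.9)–(1.12.10)** (hypothesis form): if `p` satisfies the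
three-term recurrence (1.12.8) at `x` and `B` satisfies `B_{N+1} = B_{N+2} = 0`,
`B_r = c_r + (γ_r x - α_r) B_{r+1} - β_{r+1} B_{r+2}` for `r ≤ N` (the printed (1.12.9) in the
numbering of (1.12.8), see the module docstring), then `Σ_{r=0}^{N} c_r p_r = p_0 B_0` ((1.12.10):
`f(x) = γ_0 B_0` with the text's `p_0 ≡ γ_0`). [cite: DavisRabinowitz1984, Sect. 1.12 (1.12.9)-(1.12.10)] -/
theorem clenshaw_sum_eq {γ α β : ℕ → R} {x : R} {p : ℕ → R}
    (hp : IsThreeTermRecurrence γ α β x p) (c : ℕ → R) (N : ℕ) {B : ℕ → R}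
    (hB₁ : B (N + 1) = 0) (hB₂ : B (N + 2) = 0)
    (hB : ∀ r ≤ N, B r = c r + (γ r * x - α r) * B (r + 1) - β (r + 1) * B (r + 2)) :
    ∑ r ∈ range (N + 1), c r * p r = p 0 * B 0 := by
  -- invariant of the backward sweep: `Σ_{k < r ≤ N} c_r p_r = B_{k+1} p_{k+1} - β_{k+1} B_{k+2} p_k`
  have key : ∀ d k, k + d = N →
      ∑ r ∈ Ico (k + 1) (N + 1), c r * p r
        = B (k + 1) * p (k + 1) - β (k + 1) * B (k + 2) * p k := by
    intro d
    induction d with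
    | zero =>
      intro k hk
      rw [add_zero] at hk
      subst hk
      simp [hB₁, hB₂]
    | succ d ih =>
      intro k hk
      have hk' : k + 1 + d = N := by omega
      have hlt : k + 1 < N + 1 := by omega
      rw [sum_eq_sum_Ico_succ_bot hlt, ih (k + 1) hk', hB (k + 1) (by omega), hp.add_two k]
      ring
  have h0 := key N 0 (zero_add N)
  rw [range_eq_Ico, sum_eq_sum_Ico_succ_bot (by omega : 0 < N + 1), h0, hB 0 (Nat.zero_le N),
    hp.one]
  ring

/-- **The backward recurrence (1.12.9) as a definition**: `B_r = 0` for `r > N`,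
`B_r = c_r + (γ_r x - α_r) B_{r+1} - β_{r+1} B_{r+2}` for `r ≤ N` (numbering of (1.12.8)).
[cite: DavisRabinowitz1984, Sect. 1.12 (1.12.9)] -/
def clenshawB (γ α β : ℕ → R) (x : R) (c : ℕ → R) (N : ℕ) (r : ℕ) : R :=
  if N < r then 0
  else c r + (γ r * x - α r) * clenshawB γ α β x c N (r + 1)
    - β (r + 1) * clenshawB γ α β x c N (r + 2)
termination_by N + 1 - r
decreasing_by all_goals omega

/-- `B_r = 0` above the top index. [cite: DavisRabinowitz1984, Sect. 1.12 (1.12.9)] -/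
theorem clenshawB_of_lt {γ α β : ℕ → R} {x : R} {c : ℕ → R} {N r : ℕ} (h : N < r) :
    clenshawB γ α β x c N r = 0 := by
  rw [clenshawB]; simp [h]

/-- The recurrence step of `clenshawB` for `r ≤ N`. [cite: DavisRabinowitz1984, Sect. 1.12 (1.12.9)] -/
theorem clenshawB_of_le {γ α β : ℕ → R} {x : R} {c : ℕ → R} {N r : ℕ} (h : r ≤ N) :
    clenshawB γ α β x c N r = c r + (γ r * x - α r) * clenshawB γ α β x c N (r + 1)
      - β (r + 1) * clenshawB γ α β x c N (r + 2) := by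
  rw [clenshawB]; simp [Nat.not_lt.mpr h]

/-- **(1.12.10) for the backward recurrence (1.12.9)**: `Σ_{r=0}^{N} c_r p_r = p_0 B_0`.
[cite: DavisRabinowitz1984, Sect. 1.12 (1.12.9)-(1.12.10)] -/
theorem clenshawB_sum_eq {γ α β : ℕ → R} {x : R} {p : ℕ → R}
    (hp : IsThreeTermRecurrence γ α β x p) (c : ℕ → R) (N : ℕ) :
    ∑ r ∈ range (N + 1), c r * p r = p 0 * clenshawB γ α β x c N 0 :=
  clenshaw_sum_eq hp c N (clenshawB_of_lt (by omega)) (clenshawB_of_lt (by omega))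
    (fun _ hr => clenshawB_of_le hr)

end Ring

section Field

variable {K : Type*} [Field K]

/-- **Christoffel–Darboux identity (1.12.11), cleared of denominators**: if `p(·, x)` and `p(·, y)`
satisfy the three-term recurrence (1.12.8) (same coefficients) and the norms `h_k ≠ 0` are linked to
`β` by the text's formula `β_{n+1} = (γ_{n+1}/γ_n) h_{n+1}/h_n`, then
`γ_n h_n (x - y) Σ_{k≤n} p_k(x) p_k(y)/h_k = p_{n+1}(x) p_n(y) - p_n(x) p_{n+1}(y)`.
[cite: DavisRabinowitz1984, Sect. 1.12 (1.12.11)] -/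
theorem christoffelDarboux_mul {γ α β h : ℕ → K} {x y : K} {px py : ℕ → K}
    (hx : IsThreeTermRecurrence γ α β x px) (hy : IsThreeTermRecurrence γ α β y py)
    (hh : ∀ n, h n ≠ 0)
    (hβ : ∀ n, β (n + 1) * γ n * h n = γ (n + 1) * h (n + 1)) (n : ℕ) :
    γ n * h n * (x - y) * ∑ k ∈ range (n + 1), px k * py k / h k
      = px (n + 1) * py n - px n * py (n + 1) := by
  induction n with
  | zero =>
    rw [sum_range_one, hx.one, hy.one]
    field_simp [hh 0]
    ring
  | succ n ih =>
    rw [sum_range_succ, hx.add_two n, hy.add_two n]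
    have e1 : γ (n + 1) * h (n + 1) * (x - y) * ∑ k ∈ range (n + 1), px k * py k / h k
        = β (n + 1) * (px (n + 1) * py n - px n * py (n + 1)) := by
      rw [← ih, ← hβ n]; ring
    have e2 : γ (n + 1) * h (n + 1) * (x - y) * (px (n + 1) * py (n + 1) / h (n + 1))
        = γ (n + 1) * (x - y) * (px (n + 1) * py (n + 1)) := by
      field_simp [hh (n + 1)]
    rw [mul_add, e1, e2]
    ring

/-- **Christoffel–Darboux identity (1.12.11)** as printed, for `x ≠ y`:
`Σ_{k=0}^{n} p_k(x) p_k(y)/h_k = (p_{n+1}(x) p_n(y) - p_n(x) p_{n+1}(y)) / (γ_n h_n (x - y))`.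
[cite: DavisRabinowitz1984, Sect. 1.12 (1.12.11)] -/
theorem christoffelDarboux {γ α β h : ℕ → K} {x y : K} {px py : ℕ → K}
    (hx : IsThreeTermRecurrence γ α β x px) (hy : IsThreeTermRecurrence γ α β y py)
    (hγ : ∀ n, γ n ≠ 0) (hh : ∀ n, h n ≠ 0)
    (hβ : ∀ n, β (n + 1) * γ n * h n = γ (n + 1) * h (n + 1)) (hxy : x ≠ y) (n : ℕ) :
    ∑ k ∈ range (n + 1), px k * py k / h k
      = (px (n + 1) * py n - px n * py (n + 1)) / (γ n * h n * (x - y)) := by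
  rw [← christoffelDarboux_mul hx hy hh hβ n]
  field_simp [hγ n, hh n, sub_ne_zero.mpr hxy]

end Field

/-! ## The Tschebyscheff instances -/

section Chebyshev

open Polynomial Polynomial.Chebyshev Real

/-- The recurrence coefficients `γ` of `T_n` in the numbering of (1.12.8): `γ_0 = 1`, `γ_n = 2`
(`n ≥ 1`) (the text's `γ_0 = γ_1 = 1, γ_r = 2 (r ≥ 2)` in the numbering of (1.12.9)). [cite: DavisRabinowitz1984, Sect. 1.12 (1.12.9)] -/
def chebyshevGamma (n : ℕ) : ℝ := if n = 0 then 1 else 2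

/-- `T` satisfies (1.12.8) at every point with `γ = chebyshevGamma`, `α = 0`, `β = 1`:
`T_1 = x T_0`, `T_{n+2} = 2x T_{n+1} - T_n`. [cite: DavisRabinowitz1984, Sect. 1.12 (1.12.8)] -/
theorem isThreeTermRecurrence_T (x : ℝ) :
    IsThreeTermRecurrence chebyshevGamma (fun _ => 0) (fun _ => 1) x
      (fun n => (T ℝ n).eval x) where
  one := by simp [chebyshevGamma]
  add_two n := by
    have h : T ℝ ((n + 2 : ℕ) : ℤ) = 2 * X * T ℝ ((n + 1 : ℕ) : ℤ) - T ℝ (n : ℤ) := by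
      push_cast; exact T_add_two ℝ n
    simp only [chebyshevGamma, h, eval_sub, eval_mul, eval_ofNat, eval_X, Nat.add_one_ne_zero,
      if_false]
    ring

/-- **Clenshaw's rule for a Tschebyscheff expansion** (the text's choice `α_r = 0, β_r = 1,
γ_0 = γ_1 = 1, γ_r = 2`): if `B_{N+1} = B_{N+2} = 0` and `B_r = c_r + 2x B_{r+1} - B_{r+2}` for
`1 ≤ r ≤ N`, then `Σ_{r=0}^{N} c_r T_r(x) = c_0 + x B_1 - B_2`.
[cite: DavisRabinowitz1984, Sect. 1.12 (1.12.9)-(1.12.10)] -/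
theorem clenshaw_chebyshev_T (c : ℕ → ℝ) (N : ℕ) (x : ℝ) {B : ℕ → ℝ}
    (hB₁ : B (N + 1) = 0) (hB₂ : B (N + 2) = 0)
    (hB : ∀ r, 1 ≤ r → r ≤ N → B r = c r + 2 * x * B (r + 1) - B (r + 2)) :
    ∑ r ∈ range (N + 1), c r * (T ℝ r).eval x = c 0 + x * B 1 - B 2 := by
  -- extend `B` to `r = 0` by the (1.12.8)-numbered step `B_0 = c_0 + γ_0 x B_1 - β_1 B_2`
  set B' : ℕ → ℝ := fun r => if r = 0 then c 0 + x * B 1 - B 2 else B r with hB'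
  have hB'pos : ∀ r, r ≠ 0 → B' r = B r := fun r hr => by simp [hB', hr]
  have key := clenshaw_sum_eq (isThreeTermRecurrence_T x) c N (B := B')
    (by rw [hB'pos _ (by omega), hB₁]) (by rw [hB'pos _ (by omega), hB₂]) (by
      intro r hr
      rcases Nat.eq_zero_or_pos r with h0 | hpos
      · subst h0
        simp [hB', chebyshevGamma]
      · rw [hB'pos r (by omega), hB'pos (r + 1) (by omega), hB'pos (r + 2) (by omega),
          hB r hpos hr, chebyshevGamma, if_neg (by omega)]
        ring)
  rw [key]
  simp [hB']

/-- The norms of `T_k` for the weight `(1 - x²)^{-1/2}` on `[-1, 1]`: `h_0 = π`, `h_k = π/2` (`k ≥ 1`)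
(Mathlib: `integral_eval_T_real_mul_self_measureT_zero`, `integral_T_real_mul_self_measureT_of_ne_zero`).
[cite: DavisRabinowitz1984, Sect. 1.13 (II, Norm)] -/
noncomputable def chebyshevNormSq (k : ℕ) : ℝ := if k = 0 then π else π / 2

/-- `chebyshevNormSq k` is the Mathlib integral `∫ T_k² d(measureT)`. [cite: DavisRabinowitz1984, Sect. 1.13 (II, Norm)] -/
theorem chebyshevNormSq_eq_integral (k : ℕ) :
    chebyshevNormSq k = ∫ x, (T ℝ k).eval x * (T ℝ k).eval x ∂Polynomial.Chebyshev.measureT := by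
  unfold chebyshevNormSq
  split_ifs with hk
  · subst hk
    exact_mod_cast integral_eval_T_real_mul_self_measureT_zero.symm
  · exact (integral_T_real_mul_self_measureT_of_ne_zero hk).symm

/-- For the Tschebyscheff data `γ_n h_n = π` for every `n`. [folklore] -/
private theorem chebyshevGamma_mul_normSq (n : ℕ) : chebyshevGamma n * chebyshevNormSq n = π := by
  unfold chebyshevGamma chebyshevNormSq
  split_ifs <;> ring

/-- **Christoffel–Darboux for the Tschebyscheff polynomials** ((1.12.11) with `h_0 = π`,
`h_k = π/2`, `γ_n h_n = π`), cleared form: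
`π (x - y) Σ_{k≤n} T_k(x) T_k(y)/h_k = T_{n+1}(x) T_n(y) - T_n(x) T_{n+1}(y)`.
[cite: DavisRabinowitz1984, Sect. 1.12 (1.12.11)] -/
theorem christoffelDarboux_T_mul (x y : ℝ) (n : ℕ) :
    π * (x - y) * ∑ k ∈ range (n + 1), (T ℝ k).eval x * (T ℝ k).eval y / chebyshevNormSq k
      = (T ℝ (n + 1 : ℕ)).eval x * (T ℝ n).eval y - (T ℝ n).eval x * (T ℝ (n + 1 : ℕ)).eval y := by
  have h := christoffelDarboux_mul (isThreeTermRecurrence_T x) (isThreeTermRecurrence_T y)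
    (h := chebyshevNormSq) (fun n => by unfold chebyshevNormSq; split_ifs <;> positivity)
    (fun n => by
      unfold chebyshevGamma chebyshevNormSq
      simp only [Nat.add_one_ne_zero, if_false]
      split_ifs <;> ring) n
  rw [chebyshevGamma_mul_normSq] at h
  exact h

/-- **Christoffel–Darboux for `T`, elementary form**: for `x ≠ y`,
`1 + 2 Σ_{k=1}^{n} T_k(x) T_k(y) = (T_{n+1}(x) T_n(y) - T_n(x) T_{n+1}(y)) / (x - y)`.
[cite: DavisRabinowitz1984, Sect. 1.12 (1.12.11)] -/
theorem christoffelDarboux_T {x y : ℝ} (hxy : x ≠ y) (n : ℕ) :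
    1 + 2 * ∑ k ∈ Ico 1 (n + 1), (T ℝ k).eval x * (T ℝ k).eval y
      = ((T ℝ (n + 1 : ℕ)).eval x * (T ℝ n).eval y - (T ℝ n).eval x * (T ℝ (n + 1 : ℕ)).eval y)
          / (x - y) := by
  have h := christoffelDarboux_T_mul x y n
  rw [range_eq_Ico, sum_eq_sum_Ico_succ_bot (by omega : 0 < n + 1)] at h
  have hsum : ∑ k ∈ Ico 1 (n + 1), (T ℝ k).eval x * (T ℝ k).eval y / chebyshevNormSq k
      = (2 / π) * ∑ k ∈ Ico 1 (n + 1), (T ℝ k).eval x * (T ℝ k).eval y := by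
    rw [mul_sum]
    refine sum_congr rfl fun k hk => ?_
    have hk1 : k ≠ 0 := by have := (mem_Ico.mp hk).1; omega
    simp only [chebyshevNormSq, hk1, if_false]
    field_simp
  rw [hsum] at h
  simp only [chebyshevNormSq, if_true, Nat.cast_zero, T_zero, eval_one] at h
  rw [eq_div_iff (sub_ne_zero.mpr hxy)]
  have hπ : π ≠ 0 := pi_ne_zero
  field_simp at h
  linear_combination h

end Chebyshev

end Literature.Analysis.Quadrature
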